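import Summits.Ventures.MM22.Rank333.ProfileSATBlocks

/-!
# MM22 venture — `ProfileSAT` (3/4): Sinz sequential-counter blocks

HONEST FRAMING (cell `pub-mm22`, seat engine-2 g3). The counter block used by the verified CNF encoder of
`ProfileSATEncode.lean`, with its soundness lemma (every counter clause holds under the canonical extension of an
assignment) and its variable-range lemma. Nothing here mentions matrices; no rank bound is proved here.
-/

namespace Summit.Ventures.MM22.ProfileSAT

/-! ## 7. Sinz sequential-counter blocks

A block for a member list `m_1 … m_p` with `J` thresholds has fresh variables `s_{i,j}` (`1 ≤ i ≤ p`, `1 ≤ j ≤ J`)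
at `base + (i-1)·J + (j-1)`, read «at least `j` of `m_1 … m_i` are true», and for every `i` and `j < J` the clauses
`¬s_{i-1,j+1} ∨ s_{i,j+1}`, `¬m_i ∨ ¬s_{i-1,j} ∨ s_{i,j+1}`, `¬s_{i,j+1} ∨ s_{i-1,j+1} ∨ m_i`, `¬s_{i,j+1} ∨ s_{i-1,j}`
(border cells `s_{0,·} = ff`, `s_{·,0} = tt` are constants, simplified away by `collect`). All four are true under the
canonical reading, which is all the soundness argument needs. -/

/-- Variable of the counter cell `s_{i,j}`. -/
def sv (base J i j : ℕ) : ℕ := base + (i - 1) * J + (j - 1)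

/-- Positive occurrence of `s_{i,j}` with border constants. -/
def sP (base J i j : ℕ) : ELit :=
  if j = 0 then .tt else if i = 0 then .ff else .lit (.pos (sv base J i j))

/-- Negative occurrence of `s_{i,j}` with border constants. -/
def sN (base J i j : ℕ) : ELit :=
  if j = 0 then .ff else if i = 0 then .tt else .lit (.neg (sv base J i j))

/-- The four clause families for member number `i` (variable `m`), thresholds `1 … J`. -/
def stepClauses (base J i m : ℕ) : List (List ELit) :=
  (List.range J).flatMap fun j =>
    [[sN base J (i - 1) (j + 1), sP base J i (j + 1)],
     [.lit (.neg m), sN base J (i - 1) j, sP base J i (j + 1)],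
     [sN base J i (j + 1), sP base J (i - 1) (j + 1), .lit (.pos m)],
     [sN base J i (j + 1), sP base J (i - 1) j]]

/-- Counter clauses for the members from position `i` on. -/
def counterGo (base J : ℕ) : ℕ → List ℕ → List (List ELit)
  | _, [] => []
  | i, m :: ms => stepClauses base J i m ++ counterGo base J (i + 1) ms

/-- All counter clauses of a block. -/
def counterClauses (base J : ℕ) (members : List ℕ) : List (List ELit) := counterGo base J 1 members

/-- Number of true variables among the first `i` members. -/
def prefixCnt (x : ℕ → Bool) (members : List ℕ) (i : ℕ) : ℕ := cnt x (members.take i)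

/-- Canonical value of the block cell at offset `t` (cell `s_{t/J+1, t%J+1}`). -/
def canon (x : ℕ → Bool) (members : List ℕ) (J t : ℕ) : Bool :=
  decide (t % J + 1 ≤ prefixCnt x members (t / J + 1))

/-- Overwrite an assignment on the window `[base, base+size)` by `g (· - base)`. -/
def extend (y : ℕ → Bool) (base size : ℕ) (g : ℕ → Bool) (v : ℕ) : Bool :=
  if base ≤ v ∧ v < base + size then g (v - base) else y v

/-- `extend` does not touch variables below the window. -/
theorem extend_of_lt {y : ℕ → Bool} {base size : ℕ} {g : ℕ → Bool} {v : ℕ} (hv : v < base) :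
    extend y base size g v = y v := by
  simp [extend, Nat.not_le.2 hv]

/-- `extend` does not touch variables outside the window. -/
theorem extend_of_not_mem {y : ℕ → Bool} {base size : ℕ} {g : ℕ → Bool} {v : ℕ}
    (hv : ¬ (base ≤ v ∧ v < base + size)) : extend y base size g v = y v := by
  simp [extend, hv]

/-- Counter-cell offsets stay inside the block. -/
theorem sv_off_lt {i j p J : ℕ} (hi : 1 ≤ i) (hip : i ≤ p) (hj : 1 ≤ j) (hjJ : j ≤ J) :
    (i - 1) * J + (j - 1) < p * J := by
  have h1 : (i - 1) * J + (j - 1) < (i - 1) * J + J := by omega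
  have h2 : (i - 1) * J + J = i * J := by
    conv_rhs => rw [show i = (i - 1) + 1 by omega, Nat.add_mul, Nat.one_mul]
  have h3 : i * J ≤ p * J := Nat.mul_le_mul_right _ hip
  omega

/-- Row index of a counter-cell offset. -/
theorem sv_off_div {i j J : ℕ} (hj : 1 ≤ j) (hjJ : j ≤ J) : ((i - 1) * J + (j - 1)) / J = i - 1 := by
  have hJ : 0 < J := by omega
  rw [Nat.mul_comm, Nat.mul_add_div hJ, Nat.div_eq_of_lt (by omega), Nat.add_zero]

/-- Column index of a counter-cell offset. -/
theorem sv_off_mod {i j J : ℕ} (hj : 1 ≤ j) (hjJ : j ≤ J) : ((i - 1) * J + (j - 1)) % J = j - 1 := by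
  rw [Nat.mul_comm, Nat.mul_add_mod, Nat.mod_eq_of_lt (by omega)]

/-- The canonical block assignment reads `s_{i,j} ↔ j ≤ #true among the first i members`. -/
theorem extend_sv {x y : ℕ → Bool} {members : List ℕ} {base J p i j : ℕ}
    (hi : 1 ≤ i) (hip : i ≤ p) (hj : 1 ≤ j) (hjJ : j ≤ J) :
    extend y base (p * J) (canon x members J) (sv base J i j) = decide (j ≤ prefixCnt x members i) := by
  have hlt := sv_off_lt hi hip hj hjJ
  unfold extend sv
  rw [if_pos (by constructor <;> omega)]
  have e : base + (i - 1) * J + (j - 1) - base = (i - 1) * J + (j - 1) := by omega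
  have ei : i - 1 + 1 = i := by omega
  have ej : j - 1 + 1 = j := by omega
  rw [e, canon, sv_off_div hj hjJ, sv_off_mod hj hjJ, ei, ej]

/-- Value of `sP` under the canonical block assignment. -/
theorem eval_sP {x y : ℕ → Bool} {members : List ℕ} {base J p : ℕ} (i j : ℕ)
    (hip : i ≤ p) (hjJ : j ≤ J) :
    ELit.eval (extend y base (p * J) (canon x members J)) (sP base J i j) =
      decide (j ≤ prefixCnt x members i) := by
  unfold sP
  by_cases hj0 : j = 0
  · subst hj0
    simp [ELit.eval]
  · rw [if_neg hj0]
    by_cases hi0 : i = 0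
    · subst hi0
      rw [if_pos rfl]
      have h0 : prefixCnt x members 0 = 0 := by simp [prefixCnt, cnt]
      rw [h0]
      simp only [ELit.eval]
      symm
      rw [decide_eq_false_iff_not]
      omega
    · rw [if_neg hi0]
      simp only [ELit.eval, Lit.eval]
      exact extend_sv (by omega) hip (by omega) hjJ

/-- Value of `sN` under the canonical block assignment. -/
theorem eval_sN {x y : ℕ → Bool} {members : List ℕ} {base J p : ℕ} (i j : ℕ)
    (hip : i ≤ p) (hjJ : j ≤ J) :
    ELit.eval (extend y base (p * J) (canon x members J)) (sN base J i j) =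
      !decide (j ≤ prefixCnt x members i) := by
  unfold sN
  by_cases hj0 : j = 0
  · subst hj0
    simp [ELit.eval]
  · rw [if_neg hj0]
    by_cases hi0 : i = 0
    · subst hi0
      rw [if_pos rfl]
      have h0 : prefixCnt x members 0 = 0 := by simp [prefixCnt, cnt]
      rw [h0]
      simp only [ELit.eval]
      symm
      rw [Bool.not_eq_true', decide_eq_false_iff_not]
      omega
    · rw [if_neg hi0]
      simp only [ELit.eval, Lit.eval]
      rw [extend_sv (by omega) hip (by omega) hjJ]

/-- Prefix of a concatenation (helper). -/
theorem take_done (done rest : List ℕ) : (done ++ rest).take done.length = done :=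
  List.take_append_length

/-- Prefix of a concatenation, one more element (helper). -/
theorem take_done_succ (done : List ℕ) (m : ℕ) (ms : List ℕ) :
    (done ++ m :: ms).take (done.length + 1) = done ++ [m] := by
  rw [List.take_length_add_append]
  simp

/-- Prefix count after the already processed members (helper). -/
theorem prefixCnt_done (x : ℕ → Bool) (done rest : List ℕ) :
    prefixCnt x (done ++ rest) done.length = cnt x done := by
  unfold prefixCnt
  rw [take_done]

/-- Prefix count advances by the value of the next member (helper). -/
theorem prefixCnt_step (x : ℕ → Bool) (done : List ℕ) (m : ℕ) (ms : List ℕ) :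
    prefixCnt x (done ++ m :: ms) (done.length + 1) = cnt x done + (if x m then 1 else 0) := by
  unfold prefixCnt cnt
  rw [take_done_succ, List.countP_append]
  simp

/-- `(¬ a ∨ b)`-style Boolean facts used for the four clause families. -/
theorem or_decide_helper (a b : Prop) [Decidable a] [Decidable b] (h : a → b) :
    (!decide a || decide b) = true := by
  by_cases ha : a <;> simp [ha, h]

/-- Every clause of one counter step has a true extended literal under the canonical block assignment. -/
theorem stepClauses_sound {x y : ℕ → Bool} {members : List ℕ} {base J p : ℕ} (hp : members.length = p)
    (hmem : ∀ m ∈ members, m < base) (hyx : ∀ m ∈ members, y m = x m)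
    (done : List ℕ) (m : ℕ) (ms : List ℕ) (hsplit : members = done ++ m :: ms) :
    ∀ e ∈ stepClauses base J (done.length + 1) m,
      e.any (ELit.eval (extend y base (p * J) (canon x members J))) = true := by
  intro e he
  have hm : m ∈ members := by rw [hsplit]; simp
  have hi : done.length + 1 ≤ p := by rw [← hp, hsplit]; simp
  have hi' : done.length ≤ p := Nat.le_of_succ_le hi
  -- evaluations of the cells involved
  have hYm : extend y base (p * J) (canon x members J) m = x m := by
    rw [extend_of_lt (hmem m hm), hyx m hm]
  have hc1 : prefixCnt x members (done.length + 1) = cnt x done + (if x m then 1 else 0) := by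
    rw [hsplit]; exact prefixCnt_step x done m ms
  have hc0 : prefixCnt x members done.length = cnt x done := by
    rw [hsplit]; exact prefixCnt_done x done (m :: ms)
  simp only [stepClauses, List.mem_flatMap, List.mem_range, List.mem_cons, List.not_mem_nil, or_false,
    Nat.add_sub_cancel] at he
  obtain ⟨j, hjJ, he⟩ := he
  have hPi := eval_sP (x := x) (y := y) (members := members) (base := base) (J := J) (p := p)
    (done.length + 1) (j + 1) hi (by omega)
  have hNi := eval_sN (x := x) (y := y) (members := members) (base := base) (J := J) (p := p)
    (done.length + 1) (j + 1) hi (by omega)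
  have hPp1 := eval_sP (x := x) (y := y) (members := members) (base := base) (J := J) (p := p)
    done.length (j + 1) hi' (by omega)
  have hNp1 := eval_sN (x := x) (y := y) (members := members) (base := base) (J := J) (p := p)
    done.length (j + 1) hi' (by omega)
  have hPp0 := eval_sP (x := x) (y := y) (members := members) (base := base) (J := J) (p := p)
    done.length j hi' (by omega)
  have hNp0 := eval_sN (x := x) (y := y) (members := members) (base := base) (J := J) (p := p)
    done.length j hi' (by omega)
  rw [hc1] at hPi hNi
  rw [hc0] at hPp1 hNp1 hPp0 hNp0
  rcases he with rfl | rfl | rfl | rfl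
  · -- ¬s_{i-1,j+1} ∨ s_{i,j+1}
    simp only [List.any_cons, List.any_nil, Bool.or_false, hNp1, hPi]
    apply or_decide_helper
    intro h; split <;> omega
  · -- ¬m ∨ ¬s_{i-1,j} ∨ s_{i,j+1}
    have hl : ELit.eval (extend y base (p * J) (canon x members J)) (.lit (.neg m)) = !x m := by
      simp [ELit.eval, Lit.eval, hYm]
    simp only [List.any_cons, List.any_nil, Bool.or_false]
    rw [hl, hNp0, hPi]
    cases hxm : x m
    · simp
    · simp only [Bool.not_true, Bool.false_or, if_true]
      apply or_decide_helper
      intro h; omega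
  · -- ¬s_{i,j+1} ∨ s_{i-1,j+1} ∨ m
    have hl : ELit.eval (extend y base (p * J) (canon x members J)) (.lit (.pos m)) = x m := by
      simp [ELit.eval, Lit.eval, hYm]
    simp only [List.any_cons, List.any_nil, Bool.or_false]
    rw [hl, hNi, hPp1]
    cases hxm : x m
    · simp only [Bool.or_false]
      apply or_decide_helper
      intro h; simpa using h
    · simp
  · -- ¬s_{i,j+1} ∨ s_{i-1,j}
    simp only [List.any_cons, List.any_nil, Bool.or_false, hNi, hPp0]
    apply or_decide_helper
    intro h; split at h <;> omega

/-- All counter clauses of a block hold under the canonical block assignment. -/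
theorem counterClauses_sound {x y : ℕ → Bool} {members : List ℕ} {base J p : ℕ} (hp : members.length = p)
    (hmem : ∀ m ∈ members, m < base) (hyx : ∀ m ∈ members, y m = x m) :
    ∀ e ∈ counterClauses base J members,
      e.any (ELit.eval (extend y base (p * J) (canon x members J))) = true := by
  have h : ∀ (rest done : List ℕ), members = done ++ rest →
      ∀ e ∈ counterGo base J (done.length + 1) rest,
        e.any (ELit.eval (extend y base (p * J) (canon x members J))) = true := by
    intro rest
    induction rest with
    | nil => intro done _ e he; simp [counterGo] at he
    | cons m ms ih =>
      intro done hsplit e he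
      simp only [counterGo, List.mem_append] at he
      rcases he with he | he
      · exact stepClauses_sound hp hmem hyx done m ms hsplit e he
      · exact ih (done ++ [m]) (by rw [hsplit]; simp) e (by simpa using he)
  intro e he
  exact h members [] (by simp) e (by simpa [counterClauses] using he)

/-- Variables of an `sP` cell literal. -/
theorem var_of_sP {base J p i j : ℕ} {l : Lit} (hip : i ≤ p) (hjJ : j ≤ J) (h : ELit.lit l = sP base J i j) :
    base ≤ l.var ∧ l.var < base + p * J := by
  unfold sP at h
  split_ifs at h with h1 h2
  cases h
  have := sv_off_lt (J := J) (by omega) hip (by omega) hjJ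
  simp only [Lit.var, sv]
  constructor <;> omega

/-- Variables of an `sN` cell literal. -/
theorem var_of_sN {base J p i j : ℕ} {l : Lit} (hip : i ≤ p) (hjJ : j ≤ J) (h : ELit.lit l = sN base J i j) :
    base ≤ l.var ∧ l.var < base + p * J := by
  unfold sN at h
  split_ifs at h with h1 h2
  cases h
  have := sv_off_lt (J := J) (by omega) hip (by omega) hjJ
  simp only [Lit.var, sv]
  constructor <;> omega

/-- Variables occurring in counter clauses: members or block cells. -/
theorem counterClauses_vars {members : List ℕ} {base J p : ℕ} (hp : members.length = p) :
    ∀ e ∈ counterClauses base J members, ∀ l : Lit, ELit.lit l ∈ e →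
      l.var ∈ members ∨ (base ≤ l.var ∧ l.var < base + p * J) := by
  have h : ∀ (rest done : List ℕ), members = done ++ rest →
      ∀ e ∈ counterGo base J (done.length + 1) rest, ∀ l : Lit, ELit.lit l ∈ e →
        l.var ∈ members ∨ (base ≤ l.var ∧ l.var < base + p * J) := by
    intro rest
    induction rest with
    | nil => intro done _ e he; simp [counterGo] at he
    | cons m ms ih =>
      intro done hsplit e he l hl
      have hm : m ∈ members := by rw [hsplit]; simp
      have hi : done.length + 1 ≤ p := by rw [← hp, hsplit]; simp
      have hi' : done.length ≤ p := Nat.le_of_succ_le hi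
      simp only [counterGo, List.mem_append] at he
      rcases he with he | he
      · simp only [stepClauses, List.mem_flatMap, List.mem_range, List.mem_cons, List.not_mem_nil, or_false,
          Nat.add_sub_cancel] at he
        obtain ⟨j, hjJ, he⟩ := he
        have hmv : ∀ {l' : Lit}, ELit.lit l' = ELit.lit (.pos m) ∨ ELit.lit l' = ELit.lit (.neg m) →
            l'.var ∈ members := by
          intro l' h'
          rcases h' with h' | h' <;> cases h' <;> simpa [Lit.var] using hm
        rcases he with rfl | rfl | rfl | rfl <;>
          simp only [List.mem_cons, List.not_mem_nil, or_false] at hl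
        · rcases hl with h | h
          · exact Or.inr (var_of_sN hi' (by omega) h)
          · exact Or.inr (var_of_sP hi (by omega) h)
        · rcases hl with h | h | h
          · exact Or.inl (hmv (Or.inr h))
          · exact Or.inr (var_of_sN hi' (by omega) h)
          · exact Or.inr (var_of_sP hi (by omega) h)
        · rcases hl with h | h | h
          · exact Or.inr (var_of_sN hi (by omega) h)
          · exact Or.inr (var_of_sP hi' (by omega) h)
          · exact Or.inl (hmv (Or.inl h))
        · rcases hl with h | h
          · exact Or.inr (var_of_sN hi (by omega) h)
          · exact Or.inr (var_of_sP hi' (by omega) h)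
      · exact ih (done ++ [m]) (by rw [hsplit]; simp) e (by simpa using he) l hl
  intro e he
  exact h members [] (by simp) e (by simpa [counterClauses] using he)

end Summit.Ventures.MM22.ProfileSAT
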